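import Literature.AlgebraicGeometry.HodgeTheory.CyclicCoverPencilShellInvariance
import Literature.Analysis.Calculus.AutonomousLineComparison
import HarnessLib

/-!
# The pencil coordinate is translated at unit speed along the cut-off monodromy flows (hypotheses of the fold isotopy)

Family `hodge`, layer `Literature/AlgebraicGeometry/HodgeTheory`; step A2c(v) of the programme discharging
`HodgeTheory/CyclicCoverNodalMeridianLocalMonodromyBound`. Along an integral curve `γ` of a cut-off lift `V = cutoffScalar p β χ' • X` starting in
the invariant set `A` (`CyclicCoverPencilShellInvariance`, section `Orbit`), the coefficient vector is `b(γ s) = b₀ − q(s)·e_{x₂^p}` with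
`q = pencilCoord ∘ γ`, and `q` solves the autonomous equation `q' = v(q)`, `v(z) = −χ'(b₀ − z e)·W(b₀ − z e)_{x₂^p}`; where the coefficient
cut-offs are `1` (`‖z‖ < ρW`) one has `v ≡ u`, so by `Analysis/Calculus/AutonomousLineComparison` `q(s) = q(0) + s·u` on every time segment on
which the line stays in that ball. Together with the invariance of `A` this is exactly the pair of hypotheses `h₁` (`u = 1`), `h₂` (`u = i`) of
the fold isotopy `Geometry/Manifold/DiscFoldRotationIsotopy.exists_rotationIsotopy_of_folds` for the flows of `CyclicCoverPencilCutoffFlows`.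

* `regCoeff_orbit_eq_sub_single` — `b(γ s) = b₀ − Pi.single x₂^p (q s)`… precisely `b(γ s) = b₀ − single (pencilCoord (γ s))`;
* `hasDerivAt_pencilCoord_orbit` — `q' = v(q)` along the orbit;
* `pencilCoord_orbit_eq_add` — `q(s) = q(0) + s•u` on segments where `‖q(0) + s•u‖ < ρW`;
* `fold_hypothesis_of_flow` — **for a flow `θ` of `V`: `x ∈ A`, `‖pc x + s•u‖ < ρW` on `[0,t]` ⇒ `θ(s,x) ∈ A ∧ pc(θ(s,x)) = pc x + s•u`.**

Everything is proved; no definitions, no named facts.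

## References

* [BrockerJanichIDT1982] T. Bröcker, K. Jänich, Introduction to Differential Topology (1982), (8.12) (flows of lifted constant fields).
* [ArnoldGuseinzadeVarchenko2012] V. I. Arnold, S. M. Gusein-Zade, A. N. Varchenko, Singularities of Differentiable Maps II (2012), Part I §1.1, §2.1.
-/

noncomputable section

open CategoryTheory AlgebraicGeometry MvPolynomial TopologicalSpace Set Topology Filter
open scoped Manifold ContDiff
open Literature.AlgebraicGeometry.Motives Literature.AlgebraicGeometry.Motives.UniversalHypersurface
open Literature.AlgebraicGeometry.HodgeTheory.UniversalHypersurface Literature.Geometry.ComplexAnalytic Literature.Geometry.Manifold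
open Literature.Analysis.Calculus

namespace Literature.AlgebraicGeometry.HodgeTheory

section Translation

variable {p : ℕ} {Θ : OpenPartialHomeomorph (Fin (1 + 2) → ℂ) (Fin (1 + 2) → ℂ)} {s₀ r₂ δ R''' R'' s₁ : ℝ}
variable (hp : 3 ≤ p)
  (β : (Fin (2 + 1) → ℂ) → ℝ) (χ' : (DegIndex 2 p → ℂ) → ℝ) {W : (DegIndex 2 p → ℂ) → (DegIndex 2 p → ℂ)}
  (X' : haveI := locallyOfFiniteType_regularTotal_hom ℂ 2 p (by omega)
    haveI := smoothOfRelativeDimension_regularTotal_hom ℂ 2 p (by omega)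
    letI := ComplexPoints.chartedSpace (regularTotal ℂ 2 p) (2 + Fintype.card (DegIndex 2 p))
    Π Q : ComplexPoints (regularTotal ℂ 2 p), TangentSpace (𝓡 (2 * (2 + Fintype.card (DegIndex 2 p)))) Q)
  (hXW : haveI := locallyOfFiniteType_regularTotal_hom ℂ 2 p (by omega)
    haveI := smoothOfRelativeDimension_regularTotal_hom ℂ 2 p (by omega)
    letI := ComplexPoints.chartedSpace (regularTotal ℂ 2 p) (2 + Fintype.card (DegIndex 2 p))
    ∀ Q, mfderiv (𝓡 (2 * (2 + Fintype.card (DegIndex 2 p)))) 𝓘(ℝ, DegIndex 2 p → ℂ) (fun Q' => regCoeff ℂ 2 p Q') Q (X' Q) =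
      W (regCoeff ℂ 2 p Q))
  (hW' : ∀ b (m : DegIndex 2 p), m ≠ regPowIndex 2 p 2 → W b m = 0)
  {γ : ℝ → ComplexPoints (regularTotal ℂ 2 p)}
  (hγ : haveI := locallyOfFiniteType_regularTotal_hom ℂ 2 p (by omega)
    haveI := smoothOfRelativeDimension_regularTotal_hom ℂ 2 p (by omega)
    letI := ComplexPoints.chartedSpace (regularTotal ℂ 2 p) (2 + Fintype.card (DegIndex 2 p))
    IsMIntegralCurve γ (fun Q' => cutoffScalar p β χ' Q' • X' Q'))
  (h0 : γ 0 ∈ invariantSet p Θ R''' R'' s₁)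
  {ρK : ℝ} (hR : R''' < R'') (hr : r₂ ^ 2 < R''')
  (hχK : ∀ b, χ' b ≠ 0 →
    ‖b - coeffsOf 2 p (cyclicCoverForm p (X 2 ^ (p - 2) * (X 0 * X 1) + X 0 ^ p + X 1 ^ p))‖ < ρK)
  (hρδ : ρK ≤ δ)
  (hXK : haveI := locallyOfFiniteType_regularTotal_hom ℂ 2 p (by omega)
    haveI := smoothOfRelativeDimension_regularTotal_hom ℂ 2 p (by omega)
    letI := ComplexPoints.chartedSpace (regularTotal ℂ 2 p) (2 + Fintype.card (DegIndex 2 p))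
    ∀ Q ∈ shellSet p Θ s₀ r₂ δ (fun m => coeffsOf 2 p (cyclicCoverForm p (X 2 ^ (p - 2) * (X 0 * X 1) + X 0 ^ p + X 1 ^ p)) m.1),
      mfderiv (𝓡 (2 * (2 + Fintype.card (DegIndex 2 p)))) 𝓘(ℝ, ℝ)
        (regChartExtend 2 p 2 (fun v => PhamBrieskorn.morseRadiusCutoff Θ R''' R'' (fun j => v (Sum.inr j)))) Q (X' Q) = 0)
  (hΘ : ContDiffOn ℝ ∞ Θ Θ.source) (hR'' : {z : Fin (1 + 2) → ℂ | ∑ i, ‖z i‖ ^ 2 ≤ R''} ⊆ Θ.target)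
  (hs₀₁ : s₀ ^ 2 < s₁ ^ 2) (hs₁r : s₁ ^ 2 < r₂ ^ 2)
  (hβ : ∀ y, β y ≠ 0 → y ∈ Θ.source ∧ ∑ i, ‖Θ y i‖ ^ 2 < s₀ ^ 2)
include hp hXW hW' hγ h0 hR hr hχK hρδ hXK hΘ hR'' hs₀₁ hs₁r hβ

omit hR hr hχK hρδ hXK hΘ hR'' hs₀₁ hs₁r hβ in
/-- **Along the orbit the coefficient vector is `b₀ − single x₂^p (pencilCoord)`.** [cite: BrockerJanichIDT1982, (8.12)] -/
theorem regCoeff_orbit_eq_sub_single (s : ℝ) :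
    regCoeff ℂ 2 p (γ s) =
      coeffsOf 2 p (cyclicCoverForm p (X 2 ^ (p - 2) * (X 0 * X 1) + X 0 ^ p + X 1 ^ p)) -
        Pi.single (regPowIndex 2 p 2) (pencilCoord p (γ s)) := by
  funext m
  by_cases hm : m = regPowIndex 2 p 2
  · subst hm
    rw [Pi.sub_apply, Pi.single_eq_same, coeffsOf_nodal_regPowIndex p hp, pencilCoord]
    ring
  · rw [Pi.sub_apply, Pi.single_eq_of_ne hm, sub_zero]
    exact regCoeff_orbit_eq hp β χ' X' hXW hW' hγ h0 s ⟨m, hm⟩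

-- tangent spaces of model vector spaces are the spaces themselves
set_option backward.isDefEq.respectTransparency false in
/-- **The pencil coordinate solves `q' = v(q)` along the orbit**, `v(z) = −χ'(b₀ − z e)·W(b₀ − z e)_{x₂^p}` (`e = single x₂^p 1`; here
`b₀ − z e = b₀ − single x₂^p z`). [cite: BrockerJanichIDT1982, (8.12)] -/
theorem hasDerivAt_pencilCoord_orbit (s : ℝ) :
    HasDerivAt (fun s => pencilCoord p (γ s))
      ((fun z : ℂ =>
        -((χ' (coeffsOf 2 p (cyclicCoverForm p (X 2 ^ (p - 2) * (X 0 * X 1) + X 0 ^ p + X 1 ^ p)) -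
              Pi.single (regPowIndex 2 p 2) z) : ℂ) *
          W (coeffsOf 2 p (cyclicCoverForm p (X 2 ^ (p - 2) * (X 0 * X 1) + X 0 ^ p + X 1 ^ p)) -
              Pi.single (regPowIndex 2 p 2) z) (regPowIndex 2 p 2)))
        (pencilCoord p (γ s))) s := by
  haveI := locallyOfFiniteType_regularTotal_hom ℂ 2 p (by omega)
  haveI := smoothOfRelativeDimension_regularTotal_hom ℂ 2 p (by omega)
  letI := ComplexPoints.chartedSpace (regularTotal ℂ 2 p) (2 + Fintype.card (DegIndex 2 p))
  haveI := ComplexPoints.isManifold_real (regularTotal ℂ 2 p) (2 + Fintype.card (DegIndex 2 p))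
  -- the coordinate function `g Q = b_{x₂^p}(Q)` is `C¹`
  have hg : ContMDiff (𝓡 (2 * (2 + Fintype.card (DegIndex 2 p)))) 𝓘(ℝ, ℂ) 1 (fun Q' : ComplexPoints (regularTotal ℂ 2 p) => regCoeff ℂ 2 p Q' (regPowIndex 2 p 2)) := by
    have h' : ContMDiff (𝓡 (2 * (2 + Fintype.card (DegIndex 2 p)))) 𝓘(ℝ, DegIndex 2 p → ℂ) ∞ (fun Q' : ComplexPoints (regularTotal ℂ 2 p) => regCoeff ℂ 2 p Q') :=
      fun Q => contMDiffAt_regCoeff 2 p (by omega) Q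
    have h : ContMDiff (𝓡 (2 * (2 + Fintype.card (DegIndex 2 p)))) 𝓘(ℝ, DegIndex 2 p → ℂ) 1 (fun Q' : ComplexPoints (regularTotal ℂ 2 p) => regCoeff ℂ 2 p Q') :=
      h'.of_le (by exact_mod_cast le_top)
    exact (ContinuousLinearMap.proj (R := ℝ) (regPowIndex 2 p 2) : (DegIndex 2 p → ℂ) →L[ℝ] ℂ).contMDiff.comp h
  -- chain rule along the integral curve
  have h1 : HasMFDerivAt 𝓘(ℝ, ℝ) (𝓡 (2 * (2 + Fintype.card (DegIndex 2 p)))) γ s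
      ((1 : ℝ →L[ℝ] ℝ).smulRight (cutoffScalar p β χ' (γ s) • X' (γ s))) := hγ s
  have h2 : HasMFDerivAt (𝓡 (2 * (2 + Fintype.card (DegIndex 2 p)))) 𝓘(ℝ, ℂ) (fun Q' : ComplexPoints (regularTotal ℂ 2 p) => regCoeff ℂ 2 p Q' (regPowIndex 2 p 2)) (γ s)
      (mfderiv (𝓡 (2 * (2 + Fintype.card (DegIndex 2 p)))) 𝓘(ℝ, ℂ) (fun Q' : ComplexPoints (regularTotal ℂ 2 p) => regCoeff ℂ 2 p Q' (regPowIndex 2 p 2)) (γ s)) :=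
    (hg.mdifferentiableAt one_ne_zero).hasMFDerivAt
  have h3 := h2.comp s h1
  rw [hasMFDerivAt_iff_hasFDerivAt] at h3
  have h4 := h3.hasDerivAt
  have hval : ((mfderiv (𝓡 (2 * (2 + Fintype.card (DegIndex 2 p)))) 𝓘(ℝ, ℂ)
      (fun Q' : ComplexPoints (regularTotal ℂ 2 p) => regCoeff ℂ 2 p Q' (regPowIndex 2 p 2)) (γ s)).comp
        ((1 : ℝ →L[ℝ] ℝ).smulRight (cutoffScalar p β χ' (γ s) • X' (γ s)))) (1 : ℝ) =
      (χ' (regCoeff ℂ 2 p (γ s)) : ℂ) * W (regCoeff ℂ 2 p (γ s)) (regPowIndex 2 p 2) := by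
    rw [ContinuousLinearMap.comp_apply, ContinuousLinearMap.smulRight_apply, one_apply_eq_self, one_smul,
      mfderiv_regCoeff_apply 2 p (by omega), mfderiv_regCoeff_smul 2 p (by omega) X' (cutoffScalar p β χ') hXW,
      cutoffScalar_orbit_eq hp β χ' X' hXW hW' hγ h0 hR hr hχK hρδ hXK hΘ hR'' hs₀₁ hs₁r hβ s, Pi.smul_apply,
      Complex.real_smul]
  have h5 := h4.congr_deriv hval
  -- `pencilCoord = -g`
  have h6 := h5.neg
  have hb := regCoeff_orbit_eq_sub_single hp β χ' X' hXW hW' hγ h0 s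
  refine (h6.congr_of_eventuallyEq (Eventually.of_forall fun s' => by simp [pencilCoord, Function.comp])).congr_deriv ?_
  simp only [hb]

variable {u : ℂ} {ρW : ℝ} {Kv : NNReal}
  (hχ1 : ∀ b, ‖b - coeffsOf 2 p (cyclicCoverForm p (X 2 ^ (p - 2) * (X 0 * X 1) + X 0 ^ p + X 1 ^ p))‖ < ρW → χ' b = 1)
  (hWu : ∀ b, ‖b - coeffsOf 2 p (cyclicCoverForm p (X 2 ^ (p - 2) * (X 0 * X 1) + X 0 ^ p + X 1 ^ p))‖ < ρW →
    W b (regPowIndex 2 p 2) = -u)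
  (hv : LipschitzWith Kv (fun z : ℂ =>
        -((χ' (coeffsOf 2 p (cyclicCoverForm p (X 2 ^ (p - 2) * (X 0 * X 1) + X 0 ^ p + X 1 ^ p)) -
              Pi.single (regPowIndex 2 p 2) z) : ℂ) *
          W (coeffsOf 2 p (cyclicCoverForm p (X 2 ^ (p - 2) * (X 0 * X 1) + X 0 ^ p + X 1 ^ p)) -
              Pi.single (regPowIndex 2 p 2) z) (regPowIndex 2 p 2))))
include hχ1 hWu hv

/-- **The pencil coordinate is translated: `q(s) = q(0) + s•u`** on every segment `[0, t]` with `‖q(0) + s•u‖ < ρW` on it.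
[cite: BrockerJanichIDT1982, (8.12)] -/
theorem pencilCoord_orbit_eq_add {t : ℝ} (hseg : ∀ s ∈ uIcc 0 t, ‖pencilCoord p (γ 0) + s • u‖ < ρW) {s : ℝ} (hs : s ∈ uIcc 0 t) :
    pencilCoord p (γ s) = pencilCoord p (γ 0) + s • u := by
  classical
  refine eq_add_smul_of_hasDerivAt_of_eqOn_ball (q := fun s => pencilCoord p (γ s)) hv (ρ := ρW) ?_
    (fun s => hasDerivAt_pencilCoord_orbit hp β χ' X' hXW hW' hγ h0 hR hr hχK hρδ hXK hΘ hR'' hs₀₁ hs₁r hβ s) hseg hs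
  intro z hz
  have hnorm : ‖(coeffsOf 2 p (cyclicCoverForm p (X 2 ^ (p - 2) * (X 0 * X 1) + X 0 ^ p + X 1 ^ p)) -
        Pi.single (regPowIndex 2 p 2) z) -
      coeffsOf 2 p (cyclicCoverForm p (X 2 ^ (p - 2) * (X 0 * X 1) + X 0 ^ p + X 1 ^ p))‖ < ρW := by
    rw [sub_sub_cancel_left, norm_neg, Pi.norm_single]; exact hz
  simp only [hχ1 _ hnorm, hWu _ hnorm, Complex.ofReal_one, one_mul, neg_neg]

end Translation

/-- **The fold hypotheses for a flow.** Let `θ` be a map with `θ(0, x) = x` whose curves `s ↦ θ(s, x)` are integral curves of the cut-off lift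
`cutoffScalar p β χ' • X` (as produced by `CyclicCoverPencilCutoffFlows.exists_cutoff_globalFlow`), under the hypotheses of section `Orbit` of
`CyclicCoverPencilShellInvariance` and of `pencilCoord_orbit_eq_add`. Then for `x ∈ A` and `t` with `‖pc x + s•u‖ < ρW` for all `s ∈ [0, t]`:
`θ(s, x) ∈ A` and `pc(θ(s, x)) = pc x + s•u` for all `s ∈ [0, t]` — hypotheses `h₁`/`h₂` of
`Geometry/Manifold/DiscFoldRotationIsotopy.exists_rotationIsotopy_of_folds`. [cite: BrockerJanichIDT1982, (8.12)]
[cite: ArnoldGuseinzadeVarchenko2012, Part I §2.1] -/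
theorem fold_hypothesis_of_flow {p : ℕ} (hp : 3 ≤ p)
    {Θ : OpenPartialHomeomorph (Fin (1 + 2) → ℂ) (Fin (1 + 2) → ℂ)} {s₀ r₂ δ R''' R'' s₁ : ℝ}
    (β : (Fin (2 + 1) → ℂ) → ℝ) (χ' : (DegIndex 2 p → ℂ) → ℝ) {W : (DegIndex 2 p → ℂ) → (DegIndex 2 p → ℂ)}
    (X' : haveI := locallyOfFiniteType_regularTotal_hom ℂ 2 p (by omega)
      haveI := smoothOfRelativeDimension_regularTotal_hom ℂ 2 p (by omega)
      letI := ComplexPoints.chartedSpace (regularTotal ℂ 2 p) (2 + Fintype.card (DegIndex 2 p))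
      Π Q : ComplexPoints (regularTotal ℂ 2 p), TangentSpace (𝓡 (2 * (2 + Fintype.card (DegIndex 2 p)))) Q)
    (hXW : haveI := locallyOfFiniteType_regularTotal_hom ℂ 2 p (by omega)
      haveI := smoothOfRelativeDimension_regularTotal_hom ℂ 2 p (by omega)
      letI := ComplexPoints.chartedSpace (regularTotal ℂ 2 p) (2 + Fintype.card (DegIndex 2 p))
      ∀ Q, mfderiv (𝓡 (2 * (2 + Fintype.card (DegIndex 2 p)))) 𝓘(ℝ, DegIndex 2 p → ℂ) (fun Q' => regCoeff ℂ 2 p Q') Q (X' Q) =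
        W (regCoeff ℂ 2 p Q))
    (hW' : ∀ b (m : DegIndex 2 p), m ≠ regPowIndex 2 p 2 → W b m = 0)
    {θ : ℝ × ComplexPoints (regularTotal ℂ 2 p) → ComplexPoints (regularTotal ℂ 2 p)} (hθ0 : ∀ Q, θ (0, Q) = Q)
    (hθ : haveI := locallyOfFiniteType_regularTotal_hom ℂ 2 p (by omega)
      haveI := smoothOfRelativeDimension_regularTotal_hom ℂ 2 p (by omega)
      letI := ComplexPoints.chartedSpace (regularTotal ℂ 2 p) (2 + Fintype.card (DegIndex 2 p))
      ∀ Q, IsMIntegralCurve (fun s => θ (s, Q)) (fun Q' => cutoffScalar p β χ' Q' • X' Q'))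
    {ρK : ℝ} (hR : R''' < R'') (hr : r₂ ^ 2 < R''')
    (hχK : ∀ b, χ' b ≠ 0 →
      ‖b - coeffsOf 2 p (cyclicCoverForm p (X 2 ^ (p - 2) * (X 0 * X 1) + X 0 ^ p + X 1 ^ p))‖ < ρK)
    (hρδ : ρK ≤ δ)
    (hXK : haveI := locallyOfFiniteType_regularTotal_hom ℂ 2 p (by omega)
      haveI := smoothOfRelativeDimension_regularTotal_hom ℂ 2 p (by omega)
      letI := ComplexPoints.chartedSpace (regularTotal ℂ 2 p) (2 + Fintype.card (DegIndex 2 p))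
      ∀ Q ∈ shellSet p Θ s₀ r₂ δ (fun m => coeffsOf 2 p (cyclicCoverForm p (X 2 ^ (p - 2) * (X 0 * X 1) + X 0 ^ p + X 1 ^ p)) m.1),
        mfderiv (𝓡 (2 * (2 + Fintype.card (DegIndex 2 p)))) 𝓘(ℝ, ℝ)
          (regChartExtend 2 p 2 (fun v => PhamBrieskorn.morseRadiusCutoff Θ R''' R'' (fun j => v (Sum.inr j)))) Q (X' Q) = 0)
    (hΘ : ContDiffOn ℝ ∞ Θ Θ.source) (hR'' : {z : Fin (1 + 2) → ℂ | ∑ i, ‖z i‖ ^ 2 ≤ R''} ⊆ Θ.target)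
    (hs₀₁ : s₀ ^ 2 < s₁ ^ 2) (hs₁r : s₁ ^ 2 < r₂ ^ 2)
    (hβ : ∀ y, β y ≠ 0 → y ∈ Θ.source ∧ ∑ i, ‖Θ y i‖ ^ 2 < s₀ ^ 2)
    {u : ℂ} {ρW : ℝ} {Kv : NNReal}
    (hχ1 : ∀ b, ‖b - coeffsOf 2 p (cyclicCoverForm p (X 2 ^ (p - 2) * (X 0 * X 1) + X 0 ^ p + X 1 ^ p))‖ < ρW → χ' b = 1)
    (hWu : ∀ b, ‖b - coeffsOf 2 p (cyclicCoverForm p (X 2 ^ (p - 2) * (X 0 * X 1) + X 0 ^ p + X 1 ^ p))‖ < ρW →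
      W b (regPowIndex 2 p 2) = -u)
    (hv : LipschitzWith Kv (fun z : ℂ =>
          -((χ' (coeffsOf 2 p (cyclicCoverForm p (X 2 ^ (p - 2) * (X 0 * X 1) + X 0 ^ p + X 1 ^ p)) -
                Pi.single (regPowIndex 2 p 2) z) : ℂ) *
            W (coeffsOf 2 p (cyclicCoverForm p (X 2 ^ (p - 2) * (X 0 * X 1) + X 0 ^ p + X 1 ^ p)) -
                Pi.single (regPowIndex 2 p 2) z) (regPowIndex 2 p 2))))
    {x : ComplexPoints (regularTotal ℂ 2 p)} (hx : x ∈ invariantSet p Θ R''' R'' s₁) {t : ℝ}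
    (hseg : ∀ s ∈ uIcc 0 t, ‖pencilCoord p x + s • u‖ < ρW) {s : ℝ} (hs : s ∈ uIcc 0 t) :
    θ (s, x) ∈ invariantSet p Θ R''' R'' s₁ ∧ pencilCoord p (θ (s, x)) = pencilCoord p x + s • u := by
  have h0 : (fun s => θ (s, x)) 0 ∈ invariantSet p Θ R''' R'' s₁ := by simpa [hθ0 x] using hx
  refine ⟨orbit_mem_invariantSet hp β χ' X' hXW hW' (hθ x) h0 hR hr hχK hρδ hXK hΘ hR'' hs₀₁ hs₁r s, ?_⟩
  have hseg' : ∀ s ∈ uIcc 0 t, ‖pencilCoord p ((fun s => θ (s, x)) 0) + s • u‖ < ρW := by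
    simpa [hθ0 x] using hseg
  have h := pencilCoord_orbit_eq_add hp β χ' X' hXW hW' (hθ x) h0 hR hr hχK hρδ hXK hΘ hR'' hs₀₁ hs₁r hβ hχ1 hWu hv hseg' hs
  simpa [hθ0 x] using h

end Literature.AlgebraicGeometry.HodgeTheory

end
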